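import Literature.NumberTheory.Transcendental.ExpOneTranscendenceMeasureLiouville
import HarnessLib

/-!
# Transcendence measure for `e` (Nesterenko–Waldschmidt 1996) — II: transference

Topic `Literature/NumberTheory/Transcendental`; sibling proof file of
`ExpOneTranscendenceMeasure.lean` (the named fact
`Literature.NumberTheory.Transcendental.NesterenkoWaldschmidt1996_thm_4_2`). Everything here is
PROVED; no definitions, no named facts.

This part is Lemma 1 of [NesterenkoWaldschmidt1996, §1] (quoted there from Fel'dman 1982,
Lemma 3.7): a measure of approximation of a complex number `θ` by algebraic numbers gives a
transcendence measure for `θ`. We prove it in the following form, adapted to the shape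
`d²(log L + d)` of Theorem 4 and stated with the MAHLER MEASURE `M(Q) = exp(d·h(ξ))` of the
minimal polynomial instead of its length (which avoids the factor `2^N` of Lemma 1, since
`M(Q) ≤ M(P) ≤ L(P)` for every factor `Q` of `P`):

* `NW1996.transference_irreducible`: if `Q ∈ ℤ[X]` is irreducible over `ℚ`, `n = deg Q`,
  `log M(Q) ≤ ℓ` (`ℓ ≥ 1`) and every root `ξ` of `Q` satisfies `|θ - ξ| ≥ exp(-κ n²(n+ℓ))`, then
  `|Q(θ)| ≥ exp(-(κ+3) n²(n+ℓ))`. Proof as in Fel'dman: with `ξ` the root closest to `θ`,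
  `|Q(θ)| = |a| ∏ |θ - ξᵢ| ≥ |θ - ξ| 2^{1-n} |Q'(ξ)|`, and `|Q'(ξ)| ≥ (n 2^n M(Q))^{1-n} M(Q)^{1-n}` by
  Liouville's inequality (part I) since `L(Q') ≤ n L(Q) ≤ n 2^n M(Q)`.
* `NW1996.transference`: if every irreducible `Q` with `log M(Q) ≤ ℓ` has the approximation
  property above (for its own degree), then every non-zero `P ∈ ℤ[X]` with `log M(P) ≤ ℓ`,
  `d = deg P`, satisfies `|P(θ)| ≥ exp(-(κ+3) d²(d+ℓ))` (factor `P` into irreducibles in the UFD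
  `ℤ[X]`; degrees add, Mahler measures multiply and are `≥ 1`).

## References

* [NesterenkoWaldschmidt1996] Yu. V. Nesterenko, M. Waldschmidt, *On the approximation of the values
  of exponential function and logarithm by algebraic numbers*, Mat. Zapiski 2 (1996), 23–42;
  arXiv:math/0002047, §1 Lemma 1.
* N. I. Fel'dman, *Hilbert's seventh problem*, Moscow State Univ. 1982, Lemma 3.7 (not held).
-/

noncomputable section

open Polynomial Complex Finset

namespace Literature.NumberTheory.Transcendental

namespace NW1996

/-! ### Integer polynomials: irreducibility over `ℤ` and over `ℚ` -/

/-- An irreducible `q ∈ ℤ[X]` of positive degree is primitive, hence (Gauss) irreducible over `ℚ`.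
[folklore] -/
theorem irreducible_map_rat_of_irreducible {q : ℤ[X]} (hq : Irreducible q) (hdeg : 0 < q.natDegree) :
    Irreducible (q.map (Int.castRingHom ℚ)) := by
  have hprim : q.IsPrimitive := by
    rw [isPrimitive_iff_content_eq_one]
    rcases hq.isUnit_or_isUnit q.eq_C_content_mul_primPart with hu | hu
    · rw [isUnit_C] at hu
      rw [← normalize_content, normalize_eq_one]
      exact hu
    · exfalso
      have h0 := natDegree_eq_zero_of_isUnit hu
      rw [natDegree_primPart] at h0
      omega
  have h : Int.castRingHom ℚ = algebraMap ℤ ℚ := rfl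
  rw [h]
  exact (IsPrimitive.irreducible_iff_irreducible_map_fraction_map hprim).mp hq

/-- `(ℤ → ℚ → ℂ) = (ℤ → ℂ)` on polynomials. [folklore] -/
theorem map_map_rat_complex (Q : ℤ[X]) :
    (Q.map (Int.castRingHom ℚ)).map (algebraMap ℚ ℂ) = Q.map (Int.castRingHom ℂ) := by
  rw [Polynomial.map_map]
  congr 1

/-- A polynomial irreducible over `ℚ` has positive degree. [folklore] -/
theorem natDegree_pos_of_irreducible_map {Q : ℤ[X]} (hQ : Irreducible (Q.map (Int.castRingHom ℚ))) :
    0 < Q.natDegree := by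
  have h := degree_pos_of_irreducible hQ
  rw [← natDegree_pos_iff_degree_pos,
    natDegree_map_eq_of_injective (RingHom.injective_int _)] at h
  exact h

/-- The length of the derivative: `L(Q') ≤ deg Q · L(Q)`. [folklore] -/
theorem length_derivative_le (Q : ℤ[X]) :
    (∑ k ∈ range ((derivative Q).natDegree + 1), |((derivative Q).coeff k : ℝ)|) ≤
      Q.natDegree * ∑ k ∈ range (Q.natDegree + 1), |(Q.coeff k : ℝ)| := by
  rcases Nat.eq_zero_or_pos Q.natDegree with h0 | hpos
  · have hQ' : derivative Q = 0 := derivative_of_natDegree_zero h0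
    simp [hQ', h0]
  have hsub : range ((derivative Q).natDegree + 1) ⊆ range Q.natDegree := by
    intro k hk
    rw [Finset.mem_range] at hk ⊢
    have := natDegree_derivative_le Q
    omega
  calc (∑ k ∈ range ((derivative Q).natDegree + 1), |((derivative Q).coeff k : ℝ)|)
      ≤ ∑ k ∈ range Q.natDegree, |((derivative Q).coeff k : ℝ)| :=
        Finset.sum_le_sum_of_subset_of_nonneg hsub fun _ _ _ => abs_nonneg _
    _ = ∑ k ∈ range Q.natDegree, ((k : ℝ) + 1) * |(Q.coeff (k + 1) : ℝ)| := by
        refine Finset.sum_congr rfl fun k _ => ?_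
        rw [coeff_derivative, Int.cast_mul, abs_mul]
        push_cast
        rw [abs_of_nonneg (by positivity : (0 : ℝ) ≤ (k : ℝ) + 1), mul_comm]
    _ ≤ ∑ k ∈ range Q.natDegree, (Q.natDegree : ℝ) * |(Q.coeff (k + 1) : ℝ)| := by
        refine Finset.sum_le_sum fun k hk => ?_
        refine mul_le_mul_of_nonneg_right ?_ (abs_nonneg _)
        have := Finset.mem_range.mp hk
        exact_mod_cast this
    _ = (Q.natDegree : ℝ) * ∑ k ∈ range Q.natDegree, |(Q.coeff (k + 1) : ℝ)| := by
        rw [Finset.mul_sum]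
    _ ≤ Q.natDegree * ∑ k ∈ range (Q.natDegree + 1), |(Q.coeff k : ℝ)| := by
        refine mul_le_mul_of_nonneg_left ?_ (Nat.cast_nonneg _)
        rw [Finset.sum_range_succ' (fun k => |(Q.coeff k : ℝ)|)]
        exact le_add_of_nonneg_right (abs_nonneg _)

/-! ### The irreducible case -/

/-- **Transference, irreducible case** ([NesterenkoWaldschmidt1996, Lemma 1]; Fel'dman 1982,
Lemma 3.7). If `Q ∈ ℤ[X]` is irreducible over `ℚ`, `n = deg Q`, `log M(Q) ≤ ℓ`, `ℓ ≥ 1`,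
and `|θ - ξ| ≥ exp(-κ n² (n + ℓ))` for every complex root `ξ` of `Q`, then
`|Q(θ)| ≥ exp(-(κ + 3) n² (n + ℓ))`. [cite: NesterenkoWaldschmidt1996, §1 Lemma 1] -/
theorem transference_irreducible (θ : ℂ) {κ ℓ : ℝ} (hℓ : 1 ≤ ℓ) {Q : ℤ[X]}
    (hQ : Irreducible (Q.map (Int.castRingHom ℚ)))
    (hM : Real.log (Q.map (Int.castRingHom ℂ)).mahlerMeasure ≤ ℓ)
    (happrox : ∀ ξ : ℂ, aeval ξ Q = 0 →
      Real.exp (-(κ * (Q.natDegree : ℝ) ^ 2 * (Q.natDegree + ℓ))) ≤ ‖θ - ξ‖) :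
    Real.exp (-((κ + 3) * (Q.natDegree : ℝ) ^ 2 * (Q.natDegree + ℓ))) ≤ ‖aeval θ Q‖ := by
  classical
  set n := Q.natDegree with hn
  set Qc := Q.map (Int.castRingHom ℂ) with hQc
  set M := Qc.mahlerMeasure with hMdef
  have hnpos : 0 < n := natDegree_pos_of_irreducible_map hQ
  have hQ0 : Q ≠ 0 := by
    intro h; apply hQ.ne_zero; rw [h, Polynomial.map_zero]
  have hinjC : Function.Injective (Int.castRingHom ℂ) := RingHom.injective_int _
  have hQc0 : Qc ≠ 0 := (Polynomial.map_ne_zero_iff hinjC).mpr hQ0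
  have hdegQc : Qc.natDegree = n := natDegree_map_eq_of_injective hinjC _
  have hM1 : 1 ≤ M := one_le_mahlerMeasure_map hQ0
  have hM0 : 0 < M := lt_of_lt_of_le zero_lt_one hM1
  have hMℓ : M ≤ Real.exp ℓ := by
    calc M = Real.exp (Real.log M) := (Real.exp_log hM0).symm
      _ ≤ Real.exp ℓ := Real.exp_le_exp.mpr hM
  have haevalC : ∀ (P : ℤ[X]) (z : ℂ), aeval z P = (P.map (Int.castRingHom ℂ)).eval z := by
    intro P z; rw [aeval_def, eval₂_eq_eval_map]; rfl
  -- roots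
  set a := Qc.leadingCoeff with ha
  have ha0 : a ≠ 0 := leadingCoeff_ne_zero.mpr hQc0
  have hcard : Qc.roots.card = Qc.natDegree := ((IsAlgClosed.splits Qc).natDegree_eq_card_roots).symm
  have hsplit : C a * (Qc.roots.map fun ρ => X - C ρ).prod = Qc :=
    C_leadingCoeff_mul_prod_multiset_X_sub_C hcard
  have hnodup : Qc.roots.Nodup := by
    refine nodup_roots ?_
    have hsep := (hQ.separable).map (f := algebraMap ℚ ℂ)
    rwa [map_map_rat_complex] at hsep
  have hne : Qc.roots.toFinset.Nonempty := by
    rw [Multiset.toFinset_nonempty, ne_eq, ← Multiset.card_eq_zero, hcard, hdegQc]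
    exact hnpos.ne'
  obtain ⟨ξ, hξmemF, hmin⟩ := Finset.exists_min_image Qc.roots.toFinset (fun ρ => ‖θ - ρ‖) hne
  have hξmem : ξ ∈ Qc.roots := Multiset.mem_toFinset.mp hξmemF
  have hξroot : aeval ξ Q = 0 := by
    rw [haevalC]; exact ((mem_roots hQc0).mp hξmem).eq_zero
  set rest := Qc.roots.erase ξ with hrest
  have hroots : Qc.roots = ξ ::ₘ rest := (Multiset.cons_erase hξmem).symm
  have hcard_rest : rest.card = n - 1 := by
    rw [hrest, Multiset.card_erase_of_mem hξmem, hcard, hdegQc]; rfl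
  -- `|Q(θ)| = |a| |θ - ξ| ∏ |θ - ρ|`
  have hQθ : aeval θ Q = a * ((θ - ξ) * (rest.map fun ρ => θ - ρ).prod) := by
    rw [haevalC, ← hQc, ← hsplit, eval_mul, eval_C, eval_multiset_prod, Multiset.map_map, hroots,
      Multiset.map_cons, Multiset.prod_cons]
    simp
  -- `Q'(ξ) = a ∏_{rest} (ξ - ρ)`
  have hQ'ξ : aeval ξ (derivative Q) = a * (rest.map fun ρ => ξ - ρ).prod := by
    rw [haevalC, ← derivative_map, ← hQc, ← hsplit, derivative_C_mul, eval_mul, eval_C,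
      eval_multiset_prod_X_sub_C_derivative hξmem]
  have hQ'ne : aeval ξ (derivative Q) ≠ 0 := by
    rw [hQ'ξ]
    refine mul_ne_zero ha0 ?_
    rw [Ne, Multiset.prod_eq_zero_iff]
    simp only [Multiset.mem_map, not_exists, not_and]
    intro ρ hρ h
    have hρξ : ρ ≠ ξ := ((Multiset.Nodup.mem_erase_iff hnodup).mp hρ).1
    exact hρξ (sub_eq_zero.mp h).symm
  -- the distance to the other roots
  have hfar : ∀ ρ ∈ rest, ‖ξ - ρ‖ ≤ 2 * ‖θ - ρ‖ := by
    intro ρ hρ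
    have hρmem : ρ ∈ Qc.roots := Multiset.mem_of_mem_erase hρ
    have h1 : ‖θ - ξ‖ ≤ ‖θ - ρ‖ := hmin ρ (Multiset.mem_toFinset.mpr hρmem)
    calc ‖ξ - ρ‖ = ‖(θ - ρ) - (θ - ξ)‖ := by ring_nf
      _ ≤ ‖θ - ρ‖ + ‖θ - ξ‖ := norm_sub_le _ _
      _ ≤ 2 * ‖θ - ρ‖ := by linarith
  have hprod : ‖(rest.map fun ρ => ξ - ρ).prod‖ ≤ 2 ^ (n - 1) * ‖(rest.map fun ρ => θ - ρ).prod‖ := by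
    rw [← hcard_rest]
    have key : ∀ s : Multiset ℂ, (∀ ρ ∈ s, ‖ξ - ρ‖ ≤ 2 * ‖θ - ρ‖) →
        ‖(s.map fun ρ => ξ - ρ).prod‖ ≤ 2 ^ s.card * ‖(s.map fun ρ => θ - ρ).prod‖ := by
      intro s
      induction s using Multiset.induction_on with
      | empty => intro; simp
      | cons ρ s ih =>
        intro hs
        simp only [Multiset.map_cons, Multiset.prod_cons, Multiset.card_cons, norm_mul, pow_succ]
        have h1 := hs ρ (Multiset.mem_cons_self _ _)
        have h2 := ih fun ρ' hρ' => hs ρ' (Multiset.mem_cons_of_mem hρ')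
        calc ‖ξ - ρ‖ * ‖(s.map fun ρ => ξ - ρ).prod‖
            ≤ (2 * ‖θ - ρ‖) * (2 ^ s.card * ‖(s.map fun ρ => θ - ρ).prod‖) :=
              mul_le_mul h1 h2 (norm_nonneg _) (by positivity)
          _ = 2 ^ s.card * 2 * (‖θ - ρ‖ * ‖(s.map fun ρ => θ - ρ).prod‖) := by ring
    exact key rest hfar
  -- Liouville for `Q'`
  set Λ : ℝ := n * 2 ^ n * M with hΛ
  have hlenQ' : (∑ k ∈ range ((derivative Q).natDegree + 1), |((derivative Q).coeff k : ℝ)|) ≤ Λ := by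
    refine (length_derivative_le Q).trans ?_
    rw [hΛ, mul_assoc]
    exact mul_le_mul_of_nonneg_left (length_le_two_pow_mul_mahlerMeasure Q) (Nat.cast_nonneg _)
  have hLiou := liouville hQ hξroot hQ'ne hlenQ'
  set n' := (derivative Q).natDegree with hn'
  have hn'le : n' ≤ n - 1 := natDegree_derivative_le Q
  have hΛ1 : 1 ≤ Λ := by
    rw [hΛ]
    have h1 : (1 : ℝ) ≤ n := by exact_mod_cast hnpos
    have h2 : (1 : ℝ) ≤ 2 ^ n := one_le_pow₀ (by norm_num)
    exact one_le_mul_of_one_le_of_one_le (one_le_mul_of_one_le_of_one_le h1 h2) hM1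
  -- `|Q'(ξ)| ≥ 1 / (Λ^{n-1} M^{n-1})`
  have hQ'lower : 1 ≤ Λ ^ (n - 1) * M ^ (n - 1) * ‖aeval ξ (derivative Q)‖ := by
    have h1 : (1 : ℝ) ≤ max 1 ‖ξ‖ ^ n' := one_le_pow₀ (le_max_left _ _)
    have h2 : M ^ n' ≤ M ^ (n - 1) := pow_le_pow_right₀ hM1 hn'le
    calc (1 : ℝ) ≤ max 1 ‖ξ‖ ^ n' := h1
      _ ≤ Λ ^ (n - 1) * M ^ n' * ‖aeval ξ (derivative Q)‖ := hLiou
      _ ≤ Λ ^ (n - 1) * M ^ (n - 1) * ‖aeval ξ (derivative Q)‖ := by gcongr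
  -- the elementary size bound `2^{n-1} Λ^{n-1} M^{n-1} ≤ exp(3 n² (n + ℓ))`
  have hsize : (2 : ℝ) ^ (n - 1) * (Λ ^ (n - 1) * M ^ (n - 1)) ≤
      Real.exp (3 * (n : ℝ) ^ 2 * (n + ℓ)) := by
    have h2e : (2 : ℝ) ≤ Real.exp 1 := by
      have := Real.add_one_le_exp (1 : ℝ); norm_num at this ⊢; linarith
    have hne : (n : ℝ) ≤ Real.exp n := by
      have := Real.add_one_le_exp (n : ℝ); linarith
    have hΛe : Λ ≤ Real.exp (2 * n + ℓ) := by
      rw [hΛ]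
      calc (n : ℝ) * 2 ^ n * M ≤ Real.exp n * (Real.exp 1) ^ n * Real.exp ℓ := by
            gcongr
        _ = Real.exp (2 * n + ℓ) := by
            rw [← Real.exp_nat_mul, ← Real.exp_add, ← Real.exp_add]; ring_nf
    calc (2 : ℝ) ^ (n - 1) * (Λ ^ (n - 1) * M ^ (n - 1))
        ≤ (Real.exp 1) ^ (n - 1) * ((Real.exp (2 * n + ℓ)) ^ (n - 1) * (Real.exp ℓ) ^ (n - 1)) := by
          gcongr
      _ = Real.exp ((n - 1 : ℕ) * (1 + (2 * n + ℓ) + ℓ)) := by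
          rw [← Real.exp_nat_mul, ← Real.exp_nat_mul, ← Real.exp_nat_mul, ← Real.exp_add,
            ← Real.exp_add]
          ring_nf
      _ ≤ Real.exp (3 * (n : ℝ) ^ 2 * (n + ℓ)) := by
          rw [Real.exp_le_exp]
          have hn1 : ((n - 1 : ℕ) : ℝ) = n - 1 := by
            rw [Nat.cast_sub (Nat.one_le_of_lt hnpos)]; simp
          rw [hn1]
          have h1 : (1 : ℝ) ≤ n := by exact_mod_cast hnpos
          have h0 : (0 : ℝ) ≤ n - 1 := by linarith
          have e1 : (n : ℝ) ^ 2 ≤ (n : ℝ) ^ 3 := by nlinarith [mul_nonneg h0 (sq_nonneg (n : ℝ))]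
          have e2 : (n : ℝ) * ℓ ≤ (n : ℝ) ^ 2 * ℓ := by
            nlinarith [mul_nonneg (mul_nonneg h0 (by linarith : (0 : ℝ) ≤ n)) (by linarith : (0 : ℝ) ≤ ℓ)]
          nlinarith [mul_nonneg h0 (by linarith : (0 : ℝ) ≤ ℓ)]
  -- assemble
  have hexp_split : Real.exp (-((κ + 3) * (n : ℝ) ^ 2 * (n + ℓ))) =
      Real.exp (-(κ * (n : ℝ) ^ 2 * (n + ℓ))) * Real.exp (-(3 * (n : ℝ) ^ 2 * (n + ℓ))) := by
    rw [← Real.exp_add]; ring_nf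
  have hθξ := happrox ξ hξroot
  rw [hexp_split]
  calc Real.exp (-(κ * (n : ℝ) ^ 2 * (n + ℓ))) * Real.exp (-(3 * (n : ℝ) ^ 2 * (n + ℓ)))
      ≤ ‖θ - ξ‖ * ((2 : ℝ) ^ (n - 1) * (Λ ^ (n - 1) * M ^ (n - 1)))⁻¹ := by
        refine mul_le_mul hθξ ?_ (Real.exp_nonneg _) (norm_nonneg _)
        rw [Real.exp_neg]
        exact inv_anti₀ (by positivity) hsize
    _ ≤ ‖θ - ξ‖ * ((2 : ℝ) ^ (n - 1) * (Λ ^ (n - 1) * M ^ (n - 1)))⁻¹ *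
          (Λ ^ (n - 1) * M ^ (n - 1) * ‖aeval ξ (derivative Q)‖) := by
        refine le_mul_of_one_le_right (by positivity) hQ'lower
    _ = ‖θ - ξ‖ * ((2 : ℝ) ^ (n - 1))⁻¹ * ‖aeval ξ (derivative Q)‖ := by
        have hpos : Λ ^ (n - 1) * M ^ (n - 1) ≠ 0 := by positivity
        field_simp
    _ = ‖a‖ * (‖θ - ξ‖ * (((2 : ℝ) ^ (n - 1))⁻¹ * ‖(rest.map fun ρ => ξ - ρ).prod‖)) := by
        rw [hQ'ξ, norm_mul]; ring
    _ ≤ ‖a‖ * (‖θ - ξ‖ * ‖(rest.map fun ρ => θ - ρ).prod‖) := by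
        gcongr
        rw [inv_mul_le_iff₀ (by positivity)]
        exact hprod
    _ = ‖aeval θ Q‖ := by
        rw [hQθ, norm_mul, norm_mul]

/-! ### The general case -/

/-- The Mahler measure of a factor: if `P = q * r` in `ℤ[X]` with `r ≠ 0` then `M(q) ≤ M(P)`.
[folklore] -/
theorem mahlerMeasure_le_of_mul {q r : ℤ[X]} (hr : r ≠ 0) :
    (q.map (Int.castRingHom ℂ)).mahlerMeasure ≤ ((q * r).map (Int.castRingHom ℂ)).mahlerMeasure := by
  rw [Polynomial.map_mul, mahlerMeasure_mul]
  exact le_mul_of_one_le_right (mahlerMeasure_nonneg _) (one_le_mahlerMeasure_map hr)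

/-- Products: if every member `q` of `s` is non-zero and satisfies
`|q(θ)| ≥ exp(-K · deg q · B)`, then `|(∏ s)(θ)| ≥ exp(-K · deg(∏ s) · B)`. [folklore] -/
theorem exp_le_norm_aeval_multiset_prod (θ : ℂ) (K B : ℝ) (s : Multiset ℤ[X])
    (hs : ∀ q ∈ s, q ≠ 0 ∧ Real.exp (-(K * q.natDegree * B)) ≤ ‖aeval θ q‖) :
    Real.exp (-(K * s.prod.natDegree * B)) ≤ ‖aeval θ s.prod‖ := by
  induction s using Multiset.induction_on with
  | empty => simp
  | cons q t ih =>
    have hq := hs q (Multiset.mem_cons_self _ _)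
    have ht : ∀ q' ∈ t, q' ≠ 0 ∧ Real.exp (-(K * q'.natDegree * B)) ≤ ‖aeval θ q'‖ :=
      fun q' hq' => hs q' (Multiset.mem_cons_of_mem hq')
    have ht0 : t.prod ≠ 0 := by
      rw [ne_eq, Multiset.prod_eq_zero_iff]
      exact fun h => (ht 0 h).1 rfl
    rw [Multiset.prod_cons, natDegree_mul hq.1 ht0, map_mul, norm_mul, Nat.cast_add]
    have hsplit : Real.exp (-(K * ((q.natDegree : ℝ) + (t.prod.natDegree : ℝ)) * B)) =
        Real.exp (-(K * q.natDegree * B)) * Real.exp (-(K * t.prod.natDegree * B)) := by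
      rw [← Real.exp_add]; ring_nf
    rw [hsplit]
    exact mul_le_mul hq.2 (ih ht) (Real.exp_nonneg _) (norm_nonneg _)

/-- **Transference** ([NesterenkoWaldschmidt1996, Lemma 1]; Fel'dman 1982, Lemma 3.7), in the form
used for Theorem 4 (2): let `θ ∈ ℂ`, `κ ≥ 0`, `ℓ ≥ 1`, and assume that for every `Q ∈ ℤ[X]`
irreducible over `ℚ` with `log M(Q) ≤ ℓ`, `n = deg Q`, every root `ξ` of `Q` satisfies
`|θ - ξ| ≥ exp(-κ n²(n + ℓ))`. Then every non-zero `P ∈ ℤ[X]` with `log M(P) ≤ ℓ`, `d = deg P`,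
satisfies `|P(θ)| ≥ exp(-(κ + 3) d² (d + ℓ))`. [cite: NesterenkoWaldschmidt1996, §1 Lemma 1] -/
theorem transference (θ : ℂ) {κ ℓ : ℝ} (hκ : 0 ≤ κ) (hℓ : 1 ≤ ℓ)
    (happrox : ∀ Q : ℤ[X], Irreducible (Q.map (Int.castRingHom ℚ)) →
      Real.log (Q.map (Int.castRingHom ℂ)).mahlerMeasure ≤ ℓ → ∀ ξ : ℂ, aeval ξ Q = 0 →
      Real.exp (-(κ * (Q.natDegree : ℝ) ^ 2 * (Q.natDegree + ℓ))) ≤ ‖θ - ξ‖)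
    {P : ℤ[X]} (hP : P ≠ 0) (hM : Real.log (P.map (Int.castRingHom ℂ)).mahlerMeasure ≤ ℓ) :
    Real.exp (-((κ + 3) * (P.natDegree : ℝ) ^ 2 * (P.natDegree + ℓ))) ≤ ‖aeval θ P‖ := by
  classical
  -- factor `P = (∏ factors) * u`
  obtain ⟨u, hu⟩ := UniqueFactorizationMonoid.factors_prod hP
  set F := UniqueFactorizationMonoid.factors P with hF
  obtain ⟨r, hr, hru⟩ := Polynomial.isUnit_iff.mp u.isUnit
  have hr1 : ‖(r : ℂ)‖ = 1 := by
    rcases Int.isUnit_iff.mp hr with h | h <;> simp [h]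
  have hr0 : r ≠ 0 := hr.ne_zero
  have hPeq : P = F.prod * C r := by rw [hru, hu]
  have hF0 : ∀ q ∈ F, q ≠ 0 := fun q hq =>
    (UniqueFactorizationMonoid.irreducible_of_factor q hq).ne_zero
  have hFprod0 : F.prod ≠ 0 := by
    rw [ne_eq, Multiset.prod_eq_zero_iff]; exact fun h => hF0 0 h rfl
  have hdegP : P.natDegree = F.prod.natDegree := by
    rw [hPeq, natDegree_mul_C hr0]
  have hMP : (P.map (Int.castRingHom ℂ)).mahlerMeasure = (F.prod.map (Int.castRingHom ℂ)).mahlerMeasure := by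
    rw [hPeq, Polynomial.map_mul, mahlerMeasure_mul, Polynomial.map_C, mahlerMeasure_const, eq_intCast,
      hr1, mul_one]
  have haevalP : ‖aeval θ P‖ = ‖aeval θ F.prod‖ := by
    rw [hPeq, map_mul, norm_mul, aeval_C, eq_intCast, hr1, mul_one]
  rw [hdegP, haevalP]
  set d := F.prod.natDegree with hd
  -- each factor
  have hfac : ∀ q ∈ F, q ≠ 0 ∧
      Real.exp (-((κ + 3) * q.natDegree * ((d : ℝ) * (d + ℓ)))) ≤ ‖aeval θ q‖ := by
    intro q hq
    have hq0 := hF0 q hq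
    refine ⟨hq0, ?_⟩
    have hirr : Irreducible q := UniqueFactorizationMonoid.irreducible_of_factor q hq
    -- `q` divides `F.prod`
    obtain ⟨t, ht⟩ : ∃ t, F = q ::ₘ t := Multiset.exists_cons_of_mem hq
    have hprod : F.prod = q * t.prod := by rw [ht, Multiset.prod_cons]
    have ht0 : t.prod ≠ 0 := by
      intro h; apply hFprod0; rw [hprod, h, mul_zero]
    have hdegq : q.natDegree ≤ d := by
      rw [hd, hprod, natDegree_mul hq0 ht0]; exact Nat.le_add_right _ _
    have hMq : Real.log (q.map (Int.castRingHom ℂ)).mahlerMeasure ≤ ℓ := by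
      refine le_trans (Real.log_le_log (lt_of_lt_of_le zero_lt_one (one_le_mahlerMeasure_map hq0)) ?_)
        (hMP ▸ hM)
      rw [hprod]; exact mahlerMeasure_le_of_mul ht0
    rcases Nat.eq_zero_or_pos q.natDegree with h0 | hpos
    · -- constant factor: `|c| ≥ 1`
      rw [h0, Nat.cast_zero, mul_zero, zero_mul, neg_zero, Real.exp_zero]
      rw [eq_C_of_natDegree_eq_zero h0, aeval_C, eq_intCast, norm_intCast]
      have hc : q.coeff 0 ≠ 0 := by
        intro hc; apply hq0; rw [eq_C_of_natDegree_eq_zero h0, hc, C_0]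
      rw [← Int.cast_abs]
      exact_mod_cast Int.one_le_abs hc
    · have hirrQ := irreducible_map_rat_of_irreducible hirr hpos
      have happ : ∀ ξ : ℂ, aeval ξ q = 0 →
          Real.exp (-(κ * (q.natDegree : ℝ) ^ 2 * (q.natDegree + ℓ))) ≤ ‖θ - ξ‖ :=
        fun ξ hξ => happrox q hirrQ hMq ξ hξ
      refine le_trans ?_ (transference_irreducible θ hℓ hirrQ hMq happ)
      rw [Real.exp_le_exp, neg_le_neg_iff]
      have h1 : (q.natDegree : ℝ) ≤ d := by exact_mod_cast hdegq
      have h2 : (0 : ℝ) ≤ q.natDegree := Nat.cast_nonneg _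
      have h3 : 0 ≤ κ + 3 := by linarith
      have h4 : (0 : ℝ) ≤ ℓ := by linarith
      calc (κ + 3) * (q.natDegree : ℝ) ^ 2 * (q.natDegree + ℓ)
          = (κ + 3) * q.natDegree * (q.natDegree * (q.natDegree + ℓ)) := by ring
        _ ≤ (κ + 3) * q.natDegree * ((d : ℝ) * (d + ℓ)) := by
            refine mul_le_mul_of_nonneg_left ?_ (by positivity)
            exact mul_le_mul h1 (by linarith) (by positivity) (by positivity)
  have := exp_le_norm_aeval_multiset_prod θ (κ + 3) ((d : ℝ) * (d + ℓ)) F hfac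
  rw [← hd] at this
  convert this using 2
  ring

end NW1996

end Literature.NumberTheory.Transcendental

end
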